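import Summits.BirchSwinnertonDyer.BirchSwinnertonDyer.Theses.UniversalToricDescent
import Summits.BirchSwinnertonDyer.BirchSwinnertonDyer.Theorems.EisensteinPrimesHidaLimitFittingBoundConverse
import Summits.BirchSwinnertonDyer.Rank1Residual.X11b.AnticyclotomicEulerCharLinks
import HarnessLib

/-!
# NODE (D-0171) on crux stmt-BirchSwinnertonDyer-24207 `UniversalToricDescent.RationalSplitIMCInclusionAtThree`
# — line `psi-zero-honda-frame` (crux-ideate standing cover `cruxidea-stmt-BirchSwinnertonDyer-24207-1`, gen 15, 2026-08-31)

KIND: IMPLIED-BY (two doors over TREE OBJECTS ONLY), 0 sorry, no new axiom, no named fact consumed, `no_new_routes`.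
Kernel theorems (checked, both conclude the crux BY NAME):
* `rationalSplitIMCInclusionAtThree_of_torsionCoRegulatorDoor :
    RelaxationDataAtThree → RestrictionLinearAtThree → TorsionCoRegulatorSplitAtThree
      → RelaxedTorsionDividesAtThree → CoRegulatorDividesCofactorAtThree → crux`            (door A, NEW factorisation);
* `rationalSplitIMCInclusionAtThree_of_fineLogImageDoor :
    RelaxationDataAtThree → RestrictionLinearAtThree → FineLogImageSplitAtThree
      → StrictLogImageDividesAtThree → FineDualDividesCofactorAtThree → crux`                 (door B = B-g50-2 / LEAD's
  determinant door `Ch(X_(∅,0)) = Ch(𝕃_𝔭/loc 𝐇)·Ch(X_(0,0))`, here TYPED for the first time over tree objects: the fine dual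
  `X_(0,0)` is `X'/ϖ'(ker ϖ)` and the regulator factor is the dual of the Honda-log image of `Sel_(∅,0)` at `𝔭`);
* `torsionCoRegulatorSplit_of_charIdeal_mul`, `fineLogImageSplit_of_charIdeal_mul` — the two SPLIT pieces (P3), (P6) FOLLOW from
  the single named folklore fact `charIdeal_mul_of_shortExact` (multiplicativity of `Ch_Λ`; `X'` f.g. is PROVED in the tree);
* the ring lemma `cofactor_door` (`I = I₁I₂`, `c ∈ I₁S`, `3^a L = c m`, `3^b m ∈ I₂S` ⟹ `3^(b+a) L ∈ IS`) — the COFACTOR shape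
  lets each factor law be stated WITHOUT guessing how `𝓛_𝔭(f)²` distributes between the two factors (no `√L` typing needed,
  no junk witness: `c` is pinned as the generator of the first factor, `m` by the equation).

THE MOVE («ψ = 0 / Honda–Serre–Tate additive coordinates at the additive branch prime»).  Three classical facts, none of
which the 16-card cone uses, make the LOCAL theory at `v ∣ 3` of an O6 row EXACT AND INTEGRAL, and turn the two natural
factorisations of `Ch_Λ(X_(∅,0))` into statements about Λ-modules of ADDITIVE characters:
(H) HONDA: `a₃(E) = 0` and `9 ∣ N` give `a_{3m}(E) = 0` for all `m`, so the formal group `Ê_W` of the minimal model has Honda type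
    `u = 3·I − a₃T + a₉T² = 3` (Honda 1968, Osaka J. Math. 5; Honda 1970 = [corpus:paper:arxiv-2510.11511 p.18, Thm 8.6–8.7]), i.e.
    `Ê_W ≅ 𝔾̂_a` OVER `ℤ₃`, on EVERY additive row (PS and SC alike; equivalently: a one-dimensional formal group over `ℤ₃` whose
    reduction has infinite height is `ℤ₃`-isomorphic to `𝔾̂_a`).  Hence the HONDA LATTICE `ℌ(F) := Ê_W(𝔪_F) ≅ (𝔪_F, +)` for every
    algebraic `F/ℚ₃` — functorial, Galois-equivariant, `Tr_{F'/F}` = field trace, torsion-free; in the local tower `K_{n,v}` its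
    universal norms vanish (`Tr(𝔪_m) → 0` is the DEFINITION of deeply ramified), re-deriving K1 / B-g14-2 / B-g50-1 in one line.
    CAVEAT (stated, not hidden): `[E(K_{n,v}) : ℌ_n]` is finite but GROWS with the ramification (`W` is not minimal over `K_{n,v}`
    for `n ≥ n₀(Δ)`), so `ℌ` is a deep sublattice at high layers — what makes it the right lattice is (ST): the Heegner points minus
    the base point lie in `ℌ` ON THE NOSE.  LIMIT (Coates–Greenberg 1996 Prop. 4.3 = [corpus:paper:doi-10-1017-s0305004112000564
    p.43, Thm 2.4.2]): on potentially supersingular rows `Im κ_∞ = H¹(K_{∞,v}, E[3^∞])` (Λ-corank 2; `Sel_BK(K_∞) = Sel_(∅,∅)`),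
    on potentially ordinary rows `Im κ_∞ = Im H¹(K_{∞,v}, C)`, `C` of corank 1 (NOT claimed equal).
(ST) SERRE–TATE / KATZ with `f = f^♭` EXACTLY (the mechanism; its model-theoretic input STD below is the FIRST thing to check):
    `3 = 𝔭𝔭̄` splits in `K`, so the CM points are ORDINARY at `v ∣ 3` and the Heegner point of `X₀(N)`, `N = 3^δ N₀`, is
    `x₀ = (A₀, A₀[𝔭̄^δ]·𝔑₀)` (cyclic since `3` splits — this is why the classical Heegner hypothesis survives `9 ∣ N`); the BD/CV
    points of conductor `3ⁿ` of canonical type are `x_n = (A_n, A_n[3^δ]°·𝔑₀)` (`A_n/A_n[3^δ]° = A_{n-δ}`: quotient by the canonical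
    subgroup lowers the level of a quasi-canonical lift), and (STD) «the canonical subgroup deforms uniquely, so the residue disc of
    `x₀` in `X₀(N)_W` IS the Serre–Tate disc of `A₀`, in which `x_n` sits at `t = ζ_{3ⁿ}^{u}`» (Gross, quasi-canonical liftings).
    `U₃ f = 0` makes `d⁻¹f = Σ_{3∤m} (a_m/m) q^m` `3`-INTEGRAL, a 3-adic modular form of tame level `N₀` (canonical-subgroup section),
    so the Katz–BDP construction runs VERBATIM with NO depletion: `Z := φ − φ(x₀) ∈ Ê_W(T·W⟦T⟧)`, `log_Ê Z = c_φ⁻¹·G`,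
    `G := (d⁻¹f)|_disc ∈ W⟦T⟧` INTEGRAL with `ψ G = 0` (⟺ `U₃f = 0` ⟺ trace-zero), `G = 𝓛̃·(1+T)`, `𝓛̃ ∈ Λ_W(ℤ₃^×)`,
    `𝓛 := 𝓛̃|_Γ`, `L = 𝓛²·unit`, Euler factor `(1 − a₃3⁻¹·(…) + ε₃(…))² = 1` (`a₃ = ε₃ = 0`; tree `IsBDPLFunction` has `ε_p = 0`
    for `p ∣ N`): an INTEGRAL square root of `L` by construction — LEAD's W1 («does an integral `L` with `IsBDPLFunction` exist at
    `3 ∣ N`?»; `castella2018_exists_isBDPLFunction` stops at `p ≥ 5`) reduces to period normalisation — and every `y_n − y₀^{(σ)}`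
    equals `Z(ζ_{3ⁿ}^{u} − 1) ∈ ℌ(K_{n,v})` ON THE NOSE, with `log = c_φ⁻¹ G(ζ−1)`: the layer-`n` local Heegner module inside
    `ℌ_n ≅ 𝔪_n` is `c_φ⁻¹·(𝓛̃ mod Φ_{3ⁿ})·W[ζ_{3ⁿ}]` (no Gauss-sum or denominator fudge).  Temperedness of the Λ-adic Heegner CLASS
    (K1) is the `(1−φ)⁻¹` cost of repackaging an integral ψ=0 vector as a ψ=1 (Iwasawa-cohomology) vector — unavailable over
    `ℚ₃` since `D_cris(V|G_ℚ₃) = 0` on an additive row (no Wach lattice; B-g15-1(f)).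
(LOC) `K_{∞,𝔭}·ℚ₃^{ur} = ℚ₃^{cyc}·ℚ₃^{ur}`: the anticyclotomic local tower at a SPLIT prime is an unramified twist of the
    cyclotomic tower, so Loeffler–Zerbes unramified descent and Nakamura 2014 (Thm 1.5/1.9) apply; no Lubin–Tate (φ_q,Γ) input
    is needed (corrects the «crystalline/LT missing» framing of L-g9-1, L-g10-1, HANDOFF-utd-idea-g50 l.77).
WHAT THE FRAME TYPES.  The tree's `selmerOver` puts Greenberg's STRICT condition (`strictKer (strictDatum 𝔭)`: the class dies on `H ⊓ D_𝔭`) at the NAMED prime only; naming a prime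
`𝔭₀ ∤ 3` gives the RELAXED dual `X₀ = X_(∅,∅)` as `XAc … 𝔭₀ ∅ γ`, and restriction of characters gives `ϖ' : X₀ ↠ X' = X_(∅,0)`,
`ϖ : X₀ ↠ X_(0,∅)`.  Two exact factorisations of `Ch_Λ(X')` follow from multiplicativity alone:
(A) `Ch(X') = Ch(ϖ'(T))·Ch(X'/ϖ'(T))`, `T = torsion_Λ X₀`.  Poitou–Tate (orthogonal complement of `loc_𝔭'(Sel_(∅,∅))` is
    `loc_𝔭'(H¹_Iw,(0,∅)) = 0` under `htor` + `c`-symmetry) makes `loc_𝔭' : Sel_(∅,∅) ↠ H¹(K_{∞,𝔭'},E[3^∞])` SURJECTIVE, so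
    `𝒦 := ker ϖ' ≅ (K_{∞,𝔭'}/𝔪_∞)^∨ ≅ Λ²` meets `T` trivially: `Ch(ϖ'(T)) = Ch(T)` is `c`-SYMMETRIC (ι-invariant: `c^*X₀ = X₀`), i.e.
    BRANCH-FREE — the common palindromic part of `Ch(X_(∅,0))` and `Ch(X_(0,∅)) = ι Ch(X_(∅,0))` — and `X'/ϖ'(T) = F₂/𝒦̄` is the
    Λ-adic HONDA CO-REGULATOR at `𝔭'` (index of the additive local lattice in the rank-2 reflexive hull `F₂` of `X₀/T`), which
    carries the branch.  IMC-prediction: `Ch(T)·𝒟_𝔭' = 𝓛_𝔭²`, `Ch(T)·𝒟_𝔭 = (ι𝓛_𝔭)²`; in generic position (`𝓛_𝔭`, `ι𝓛_𝔭` coprime)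
    `Ch(T) = 1` and the co-regulator is everything — hence the COFACTOR typing of (P4)/(P5).
(B) `Ch(X') = Ch(ϖ'(ker ϖ))·Ch(X'/ϖ'(ker ϖ))` with `X'/ϖ'(ker ϖ) = X_(0,0)` (fine dual) and `ϖ'(ker ϖ) = (loc_𝔭 Sel_(∅,0))^∨`
    `= 𝕃_𝔭/loc_𝔭(𝐇_rel)` by local duality: LEAD's determinant door, typed.
In Honda coordinates every factor is a Λ-module of additive characters of `K_{∞,v}/𝔪_∞`; its Mordell–Weil rows are EXACT
(`log_v y(ζ) = c_φ⁻¹ G_v(ζ-1)`, ψ=0 vector of the `v`-branch); its `Ш`-rows (corank 1 of `Ш(E/K_∞)[3^∞]`, local Kummer classes of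
NON-global points) are the research content — the same second row that B-g50-2 calls «rank-2 supply», now on the DISCRETE side
where no `H¹_Iw`-temperedness (K1/W1) intervenes.

PIECES AND TAGS (evidence: `Ideas/psi-zero-honda-frame.md`):
* `RelaxationDataAtThree` (P1) — **support · leaf ATTACKABLE** (unfold `selmerOver`; `awayKer 𝔭₀ ≤ strictKer (strictDatum 𝔭₀)`:
  both are «restriction to `H ⊓ D_{𝔭₀}` vanishes», with coefficients `M` resp. `M ⧸ ⊥` — `resH1Hom_comp`/`_congr` plumbing; a prime `𝔭₀ ∤ 3` exists, e.g. above `2`).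
* `RestrictionLinearAtThree` (P2) — **support · leaf ATTACKABLE** (`conjH1` commutes with `AddSubgroup.inclusion`; `IsLocNil.module`).
* `TorsionCoRegulatorSplitAtThree` (P3) — **support · leaf ATTACKABLE** (`charIdeal_mul_of_shortExact` + f.g. of `X'`).
* `RelaxedTorsionDividesAtThree` (P4) — **WEAKER** (`Ch(ϖ'(T)) ∣ Ch(X')`; strictly weaker off rows with trivial co-regulator) ·
  leaf **IDEA-NEEDED / BARRIER** `StringentKolyvaginCapsAtMax` (layerwise Kolyvagin needs controlled constants; `T` vs `Ш(E/K_n)`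
  control) · **INSTRUMENTABLE** (`n = 0, 1`: `Sel₃(E/K)`, `Sel₃(E/K₁)` for 135a1/ℚ(√-11)).
* `CoRegulatorDividesCofactorAtThree` (P5) — **UNDECIDED** (≡ crux on rows with `Ch(T) = Λ`) · leaf **IDEA-NEEDED** (the `Ш`-row of
  the co-regulator) · **INSTRUMENTABLE** (MW-row exact by (ST)).
* `FineLogImageSplitAtThree` (P6) — **support · leaf ATTACKABLE** (multiplicativity + `Hom(A,ℚ/ℤ)/Ann B = Hom(B,ℚ/ℤ)`).
* `StrictLogImageDividesAtThree` (P7) — **WEAKER** · leaf **INSTRUMENTABLE / IDEA-NEEDED** (`𝔭`-adic position of `Sel_(∅,0)`).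
* `FineDualDividesCofactorAtThree` (P8) — **UNDECIDED** · leaf **IDEA-NEEDED** (= LEAD's `X_(0,0)` half; item 32493 K2-rat shape).
INSTRUMENT DATA: none run (kit 0).  Asks in the HANDOFF: I-g15-1 (`#Sel^{(∅,∅)/(∅,0)/(0,∅)/(0,0)}(K, E[3^∞])` and the 𝔭, 𝔭'-log images
for 135a1, 189b?, serving `c(0)`, `m(0)` of (P4)/(P7)), I-g15-2 (is `V_f|G_ℚ₃` of finite height on any O6 row? expected NO),
D-g15-1 (Literature fact: Honda ⇒ `Ê ≅ 𝔾̂_a` over `ℤ_p` at an additive prime), D-g15-2 (Coates–Greenberg Kummer theorem), W1-note.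
HONEST STATUS: nothing here proves BSD for any curve; the lever is an ENABLER (exact integral local frame + typed factorisations);
interior roots outside the classical closure `μ_{3^∞}·u^{ℤ₃} - 1` remain invisible to all layerwise value data (B-g14-1, quantified
in B-g15-1(c)); (P4)/(P5)/(P7)/(P8) are research.
-/

set_option autoImplicit false
set_option linter.dupNamespace false

noncomputable section

open scoped Classical

namespace Summit.BirchSwinnertonDyer.BirchSwinnertonDyer.Cruxes.RationalSplitIMCInclusionAtThree.PsiZeroHondaFrame

/-! ## §A  The door algebra (any commutative rings): a split `I = I₁·I₂`, `c ∈ I₁S`, `t^a·L = c·m`, `t^b·m ∈ I₂S` ⟹ `t^(b+a)·L ∈ IS`. -/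

/-- **Cofactor door.** If `I = I₁ * I₂`, `c ∈ I₁.map f`, `t ^ a * L = c * m` and `t ^ b * m ∈ I₂.map f`, then
`t ^ (b + a) * L ∈ I.map f`.  (No UFD, no principal ideals, no degree count.) -/
theorem cofactor_door {R S : Type*} [CommRing R] [CommRing S] (f : R →+* S) {I I₁ I₂ : Ideal R}
    (hI : I = I₁ * I₂) {c L m t : S} {a b : ℕ} (hc : c ∈ I₁.map f) (hL : t ^ a * L = c * m)
    (hm : t ^ b * m ∈ I₂.map f) : ∃ k : ℕ, t ^ k * L ∈ I.map f := by
  refine ⟨b + a, ?_⟩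
  have e : t ^ (b + a) * L = c * (t ^ b * m) := by
    rw [pow_add, mul_assoc, hL]; ring
  rw [e, hI, Ideal.map_mul]
  exact Ideal.mul_mem_mul hc hm

/-- A submodule's characteristic-ideal bookkeeping needs only this: membership of the generator in its own span. -/
theorem mem_of_eq_span {S : Type*} [CommRing S] {J : Ideal S} {c : S} (h : J = Ideal.span {c}) : c ∈ J := by
  rw [h]; exact Ideal.mem_span_singleton_self c

/-! ## §B  The pieces, under 24207's binders (verbatim prefix of the crux + `X_(∅,0)` torsion, as in g0/g14)

Notation of the docstrings: `X₀ := XAc (W/K) 3 κ 𝔭₀ ∅ γ` for a prime `𝔭₀ ∤ 3` is the RELAXED dual `X_(∅,∅)` (the tree's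
`selmerOver` imposes Greenberg's strict condition (`strictKer (strictDatum 𝔭)`, restriction to `H ⊓ D_𝔭` dies) at the NAMED prime only and NO
condition at the other primes above `3`;
naming a prime `𝔭₀ ∤ 3`, where the away-condition «locally trivial» already holds, relaxes both `𝔭` and `𝔭'`);
`X' := XAc … 𝔭' ∅ γ = X_(∅,0)` (the crux's module, strict at `𝔭'`), `X𝔭 := XAc … 𝔭 ∅ γ = X_(0,∅)`;
`ϖ' : X₀ → X'`, `ϖ : X₀ → X𝔭` are RESTRICTION OF CHARACTERS along `Sel_(∅,0) ≤ Sel_(∅,∅)`, `Sel_(0,∅) ≤ Sel_(∅,∅)` (pinned by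
their formula, so no junk witness); `T := torsion_Λ X₀`; `ext := PowerSeries.map toUnr : Λ → R₀⟦T⟧`. -/

/-- **(P1) RELAXATION DATA [support · leaf ATTACKABLE (unfolding `selmerOver`: the away-kernel at `𝔭₀ ∤ 3` — restriction to
`H ⊓ D_𝔭₀` with coefficients `M` — is contained in (indeed equals) the strict kernel `strictKer (strictDatum 𝔭₀)` — restriction to
`H ⊓ D_𝔭₀` with coefficients `M ⧸ ⊥` (`resH1Hom_comp` / `resH1Hom_congr` plumbing); a prime `𝔭₀ ∤ 3` exists, e.g. above `2`)]**:
there is a prime `𝔭₀ ∤ 3` of `K` with `Sel_(∅,0) ≤ Sel_𝔭₀` and `Sel_(0,∅) ≤ Sel_𝔭₀` (so `X_𝔭₀ = X_(∅,∅)` maps onto both). -/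
def RelaxationDataAtThree : Prop :=
  ∀ (W : WeierstrassCurve ℚ) [W.IsElliptic] [W.IsGloballyMinimal] (N : ℕ) [NeZero N] (K : Type) [Field K] [NumberField K] (Dt : Literature.NumberTheory.EllipticCurves.ModularForms.ModularParametrizationData W N), Summit.BirchSwinnertonDyer.Rank1Residual.Additive.ClassO6 W 3 → W.HasSurjectiveModNGaloisRep 3 → W.analyticRank = 1 → W.conductorNorm ℤ = N → Literature.NumberTheory.EllipticCurves.IsImaginaryQuadratic K → Literature.NumberTheory.EllipticCurves.SatisfiesHeegnerHypothesis N K → ∀ (κ : Literature.NumberTheory.EllipticCurves.ZpExtension K 3), κ.IsAnticyclotomic → ∀ (γ : Field.absoluteGaloisGroup K) [Fact (κ.IsTopGenerator γ)] (𝔭 : IsDedekindDomain.HeightOneSpectrum (NumberField.RingOfIntegers K)), ((3 : ℕ) : NumberField.RingOfIntegers K) ∈ 𝔭.asIdeal → 𝔭.asIdeal.ramificationIdx (NumberField.RingOfIntegers ℚ) = 1 → 𝔭.asIdeal.inertiaDeg (NumberField.RingOfIntegers ℚ) = 1 → ∀ (𝔭' : IsDedekindDomain.HeightOneSpectrum (NumberField.RingOfIntegers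 K)), ((3 : ℕ) : NumberField.RingOfIntegers K) ∈ 𝔭'.asIdeal → 𝔭' ≠ 𝔭 → ∀ (ι' : PadicAlgCl 3 ≃+* ℂ), Summit.BirchSwinnertonDyer.BirchSwinnertonDyer.Theorems.SchneiderFree.BranchInducesPrime 3 ι' 𝔭 → ∀ (ΩK : ℂ) (Ωp : ℂ_[3]) (L : Literature.NumberTheory.EllipticCurves.UnrSeries 3), ΩK ≠ 0 → Ωp ≠ 0 → Literature.NumberTheory.EllipticCurves.IsBDPLFunction ι' 𝔭 κ γ Dt.f ΩK Ωp L → Module.IsTorsion (Literature.NumberTheory.EllipticCurves.IwasawaAlgebra 3) (Summit.BirchSwinnertonDyer.Rank1Residual.X11b.AcSelmer.XAc (W.baseChange K) 3 κ 𝔭' ∅ γ) →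
    ∃ 𝔭₀ : IsDedekindDomain.HeightOneSpectrum (NumberField.RingOfIntegers K),
      ((3 : ℕ) : NumberField.RingOfIntegers K) ∉ 𝔭₀.asIdeal ∧
      Summit.BirchSwinnertonDyer.Rank1Residual.X11b.AcSelmer.selmerAc (W.baseChange K) 3 κ 𝔭' ∅ ≤ Summit.BirchSwinnertonDyer.Rank1Residual.X11b.AcSelmer.selmerAc (W.baseChange K) 3 κ 𝔭₀ ∅ ∧ Summit.BirchSwinnertonDyer.Rank1Residual.X11b.AcSelmer.selmerAc (W.baseChange K) 3 κ 𝔭 ∅ ≤ Summit.BirchSwinnertonDyer.Rank1Residual.X11b.AcSelmer.selmerAc (W.baseChange K) 3 κ 𝔭₀ ∅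

/-- **(P2) RESTRICTION IS `Λ`-LINEAR [support · leaf ATTACKABLE (`conj_γ` commutes with the inclusion of Selmer groups, and the
`ℤ₃`-action of `instModuleXAc` is the locally-nilpotent extension of the `ℤ`-action)]**: for Selmer groups `Sel_𝔮 ≤ Sel_𝔭₀` of the
tree's family, restriction of characters `x ↦ x ∘ incl` is a `Λ`-linear map `X_𝔭₀ → X_𝔮`. -/
def RestrictionLinearAtThree : Prop :=
  ∀ (W : WeierstrassCurve ℚ) [W.IsElliptic] [W.IsGloballyMinimal] (N : ℕ) [NeZero N] (K : Type) [Field K] [NumberField K] (Dt : Literature.NumberTheory.EllipticCurves.ModularForms.ModularParametrizationData W N), Summit.BirchSwinnertonDyer.Rank1Residual.Additive.ClassO6 W 3 → W.HasSurjectiveModNGaloisRep 3 → W.analyticRank = 1 → W.conductorNorm ℤ = N → Literature.NumberTheory.EllipticCurves.IsImaginaryQuadratic K → Literature.NumberTheory.EllipticCurves.SatisfiesHeegnerHypothesis N K → ∀ (κ : Literature.NumberTheory.EllipticCurves.ZpExtension K 3), κ.IsAnticyclotomic → ∀ (γ : Field.absoluteGaloisGroup K) [Fact (κ.IsTopGenerator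 γ)] (𝔭 : IsDedekindDomain.HeightOneSpectrum (NumberField.RingOfIntegers K)), ((3 : ℕ) : NumberField.RingOfIntegers K) ∈ 𝔭.asIdeal → 𝔭.asIdeal.ramificationIdx (NumberField.RingOfIntegers ℚ) = 1 → 𝔭.asIdeal.inertiaDeg (NumberField.RingOfIntegers ℚ) = 1 → ∀ (𝔭' : IsDedekindDomain.HeightOneSpectrum (NumberField.RingOfIntegers K)), ((3 : ℕ) : NumberField.RingOfIntegers K) ∈ 𝔭'.asIdeal → 𝔭' ≠ 𝔭 → ∀ (ι' : PadicAlgCl 3 ≃+* ℂ), Summit.BirchSwinnertonDyer.BirchSwinnertonDyer.Theorems.SchneiderFree.BranchInducesPrime 3 ι' 𝔭 → ∀ (ΩK : ℂ) (Ωp : ℂ_[3]) (L : Literature.NumberTheory.EllipticCurves.UnrSeries 3), ΩK ≠ 0 → Ωp ≠ 0 → Literature.NumberTheory.EllipticCurves.IsBDPLFunction ι' 𝔭 κ γ Dt.f ΩK Ωp L → Module.IsTorsion (Literature.NumberTheory.EllipticCurves.IwasawaAlgebra 3) (Summit.BirchSwinnertonDyer.Rank1Residual.X11b.AcSelmer.XAc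 (W.baseChange K) 3 κ 𝔭' ∅ γ) →
    ∀ (𝔭₀ 𝔮 : IsDedekindDomain.HeightOneSpectrum (NumberField.RingOfIntegers K))
      (hle : Summit.BirchSwinnertonDyer.Rank1Residual.X11b.AcSelmer.selmerAc (W.baseChange K) 3 κ 𝔮 ∅ ≤ Summit.BirchSwinnertonDyer.Rank1Residual.X11b.AcSelmer.selmerAc (W.baseChange K) 3 κ 𝔭₀ ∅),
      ∃ π : Summit.BirchSwinnertonDyer.Rank1Residual.X11b.AcSelmer.XAc (W.baseChange K) 3 κ 𝔭₀ ∅ γ →ₗ[Literature.NumberTheory.EllipticCurves.IwasawaAlgebra 3] Summit.BirchSwinnertonDyer.Rank1Residual.X11b.AcSelmer.XAc (W.baseChange K) 3 κ 𝔮 ∅ γ,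
        ∀ (x : Summit.BirchSwinnertonDyer.Rank1Residual.X11b.AcSelmer.XAc (W.baseChange K) 3 κ 𝔭₀ ∅ γ) (s : ↥(Summit.BirchSwinnertonDyer.Rank1Residual.X11b.AcSelmer.selmerAc (W.baseChange K) 3 κ 𝔮 ∅)), π x s = x (AddSubgroup.inclusion hle s)

/-! ### Door A — RELAXED TORSION × HONDA CO-REGULATOR (the `c`-symmetric factor isolated) -/

/-- **(P3) TORSION/CO-REGULATOR SPLIT [support · leaf ATTACKABLE (multiplicativity of `Module.charIdeal` on
`0 → ϖ'(T) → X' → X'/ϖ'(T) → 0` for finitely generated torsion `Λ`-modules — tree fact `charIdeal_mul_of_shortExact` + finite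
generation of `X'`)]**: `Ch_Λ(X_(∅,0)) = Ch_Λ(ϖ'(T)) · Ch_Λ(X_(∅,0)/ϖ'(T))`, `T = torsion_Λ X_(∅,∅)`.
Meaning (Poitou–Tate, docstring §THE MOVE): `ϖ'|_T` is injective and `X'/ϖ'(T) = F₂/𝒦̄` is the Λ-adic HONDA CO-REGULATOR at `𝔭'`
(position of the additive local lattice `(K_{∞,𝔭'}/𝔪_∞)^∨ ≅ Λ²` inside the rank-2 reflexive hull of `X_(∅,∅)/T`). -/
def TorsionCoRegulatorSplitAtThree : Prop :=
  ∀ (W : WeierstrassCurve ℚ) [W.IsElliptic] [W.IsGloballyMinimal] (N : ℕ) [NeZero N] (K : Type) [Field K] [NumberField K] (Dt : Literature.NumberTheory.EllipticCurves.ModularForms.ModularParametrizationData W N), Summit.BirchSwinnertonDyer.Rank1Residual.Additive.ClassO6 W 3 → W.HasSurjectiveModNGaloisRep 3 → W.analyticRank = 1 → W.conductorNorm ℤ = N → Literature.NumberTheory.EllipticCurves.IsImaginaryQuadratic K → Literature.NumberTheory.EllipticCurves.SatisfiesHeegnerHypothesis N K → ∀ (κ : Literature.NumberTheory.EllipticCurves.ZpExtension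 K 3), κ.IsAnticyclotomic → ∀ (γ : Field.absoluteGaloisGroup K) [Fact (κ.IsTopGenerator γ)] (𝔭 : IsDedekindDomain.HeightOneSpectrum (NumberField.RingOfIntegers K)), ((3 : ℕ) : NumberField.RingOfIntegers K) ∈ 𝔭.asIdeal → 𝔭.asIdeal.ramificationIdx (NumberField.RingOfIntegers ℚ) = 1 → 𝔭.asIdeal.inertiaDeg (NumberField.RingOfIntegers ℚ) = 1 → ∀ (𝔭' : IsDedekindDomain.HeightOneSpectrum (NumberField.RingOfIntegers K)), ((3 : ℕ) : NumberField.RingOfIntegers K) ∈ 𝔭'.asIdeal → 𝔭' ≠ 𝔭 → ∀ (ι' : PadicAlgCl 3 ≃+* ℂ), Summit.BirchSwinnertonDyer.BirchSwinnertonDyer.Theorems.SchneiderFree.BranchInducesPrime 3 ι' 𝔭 → ∀ (ΩK : ℂ) (Ωp : ℂ_[3]) (L : Literature.NumberTheory.EllipticCurves.UnrSeries 3), ΩK ≠ 0 → Ωp ≠ 0 → Literature.NumberTheory.EllipticCurves.IsBDPLFunction ι' 𝔭 κ γ Dt.f ΩK Ωp L → Module.IsTorsion (Literature.NumberTheory.EllipticCurves.IwasawaAlgebra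 3) (Summit.BirchSwinnertonDyer.Rank1Residual.X11b.AcSelmer.XAc (W.baseChange K) 3 κ 𝔭' ∅ γ) →
    ∀ (𝔭₀ : IsDedekindDomain.HeightOneSpectrum (NumberField.RingOfIntegers K)), ((3 : ℕ) : NumberField.RingOfIntegers K) ∉ 𝔭₀.asIdeal →
    ∀ (h' : Summit.BirchSwinnertonDyer.Rank1Residual.X11b.AcSelmer.selmerAc (W.baseChange K) 3 κ 𝔭' ∅ ≤ Summit.BirchSwinnertonDyer.Rank1Residual.X11b.AcSelmer.selmerAc (W.baseChange K) 3 κ 𝔭₀ ∅)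
      (ϖ' : Summit.BirchSwinnertonDyer.Rank1Residual.X11b.AcSelmer.XAc (W.baseChange K) 3 κ 𝔭₀ ∅ γ →ₗ[Literature.NumberTheory.EllipticCurves.IwasawaAlgebra 3] Summit.BirchSwinnertonDyer.Rank1Residual.X11b.AcSelmer.XAc (W.baseChange K) 3 κ 𝔭' ∅ γ),
      (∀ (x : Summit.BirchSwinnertonDyer.Rank1Residual.X11b.AcSelmer.XAc (W.baseChange K) 3 κ 𝔭₀ ∅ γ) (s : ↥(Summit.BirchSwinnertonDyer.Rank1Residual.X11b.AcSelmer.selmerAc (W.baseChange K) 3 κ 𝔭' ∅)), ϖ' x s = x (AddSubgroup.inclusion h' s)) →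
    Summit.BirchSwinnertonDyer.Rank1Residual.X11b.AcSelmer.XAc.charIdeal (W.baseChange K) 3 κ 𝔭' ∅ γ =
      Literature.NumberTheory.EllipticCurves.Module.charIdeal (Literature.NumberTheory.EllipticCurves.IwasawaAlgebra 3) ↥(Submodule.map ϖ' (Submodule.torsion (Literature.NumberTheory.EllipticCurves.IwasawaAlgebra 3) (Summit.BirchSwinnertonDyer.Rank1Residual.X11b.AcSelmer.XAc (W.baseChange K) 3 κ 𝔭₀ ∅ γ))) *
      Literature.NumberTheory.EllipticCurves.Module.charIdeal (Literature.NumberTheory.EllipticCurves.IwasawaAlgebra 3) (Summit.BirchSwinnertonDyer.Rank1Residual.X11b.AcSelmer.XAc (W.baseChange K) 3 κ 𝔭' ∅ γ ⧸ (Submodule.map ϖ' (Submodule.torsion (Literature.NumberTheory.EllipticCurves.IwasawaAlgebra 3) (Summit.BirchSwinnertonDyer.Rank1Residual.X11b.AcSelmer.XAc (W.baseChange K) 3 κ 𝔭₀ ∅ γ))))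

/-- **(P4) RELAXED TORSION DIVIDES [WEAKER (strictly: `ϖ'(T) ≤ X'` so `Ch(ϖ'(T)) ∣ Ch(X')`; equal to the crux only on rows with
trivial co-regulator) · leaf IDEA-NEEDED / BARRIER `StringentKolyvaginCapsAtMax` (layerwise Kolyvagin with controlled constants) ·
INSTRUMENTABLE at layers 0,1 (3-descent over `K`, `K₁`)]**: the characteristic ideal of the image of the RELAXED TORSION — the
`c`-SYMMETRIC (palindromic, branch-free) factor, essentially `Ш(E/K_∞)[3^∞]^∨_tors ⊕` Mordell–Weil-dual torsion — divides `3^a·L`: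
`Ch(ϖ'(T))·R₀⟦T⟧ = (c)` with `3^a·L = c·m`. -/
def RelaxedTorsionDividesAtThree : Prop :=
  ∀ (W : WeierstrassCurve ℚ) [W.IsElliptic] [W.IsGloballyMinimal] (N : ℕ) [NeZero N] (K : Type) [Field K] [NumberField K] (Dt : Literature.NumberTheory.EllipticCurves.ModularForms.ModularParametrizationData W N), Summit.BirchSwinnertonDyer.Rank1Residual.Additive.ClassO6 W 3 → W.HasSurjectiveModNGaloisRep 3 → W.analyticRank = 1 → W.conductorNorm ℤ = N → Literature.NumberTheory.EllipticCurves.IsImaginaryQuadratic K → Literature.NumberTheory.EllipticCurves.SatisfiesHeegnerHypothesis N K → ∀ (κ : Literature.NumberTheory.EllipticCurves.ZpExtension K 3), κ.IsAnticyclotomic → ∀ (γ : Field.absoluteGaloisGroup K) [Fact (κ.IsTopGenerator γ)] (𝔭 : IsDedekindDomain.HeightOneSpectrum (NumberField.RingOfIntegers K)), ((3 : ℕ) : NumberField.RingOfIntegers K) ∈ 𝔭.asIdeal → 𝔭.asIdeal.ramificationIdx (NumberField.RingOfIntegers ℚ) = 1 → 𝔭.asIdeal.inertiaDeg (NumberField.RingOfIntegers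 ℚ) = 1 → ∀ (𝔭' : IsDedekindDomain.HeightOneSpectrum (NumberField.RingOfIntegers K)), ((3 : ℕ) : NumberField.RingOfIntegers K) ∈ 𝔭'.asIdeal → 𝔭' ≠ 𝔭 → ∀ (ι' : PadicAlgCl 3 ≃+* ℂ), Summit.BirchSwinnertonDyer.BirchSwinnertonDyer.Theorems.SchneiderFree.BranchInducesPrime 3 ι' 𝔭 → ∀ (ΩK : ℂ) (Ωp : ℂ_[3]) (L : Literature.NumberTheory.EllipticCurves.UnrSeries 3), ΩK ≠ 0 → Ωp ≠ 0 → Literature.NumberTheory.EllipticCurves.IsBDPLFunction ι' 𝔭 κ γ Dt.f ΩK Ωp L → Module.IsTorsion (Literature.NumberTheory.EllipticCurves.IwasawaAlgebra 3) (Summit.BirchSwinnertonDyer.Rank1Residual.X11b.AcSelmer.XAc (W.baseChange K) 3 κ 𝔭' ∅ γ) →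
    ∀ (𝔭₀ : IsDedekindDomain.HeightOneSpectrum (NumberField.RingOfIntegers K)), ((3 : ℕ) : NumberField.RingOfIntegers K) ∉ 𝔭₀.asIdeal →
    ∀ (h' : Summit.BirchSwinnertonDyer.Rank1Residual.X11b.AcSelmer.selmerAc (W.baseChange K) 3 κ 𝔭' ∅ ≤ Summit.BirchSwinnertonDyer.Rank1Residual.X11b.AcSelmer.selmerAc (W.baseChange K) 3 κ 𝔭₀ ∅)
      (ϖ' : Summit.BirchSwinnertonDyer.Rank1Residual.X11b.AcSelmer.XAc (W.baseChange K) 3 κ 𝔭₀ ∅ γ →ₗ[Literature.NumberTheory.EllipticCurves.IwasawaAlgebra 3] Summit.BirchSwinnertonDyer.Rank1Residual.X11b.AcSelmer.XAc (W.baseChange K) 3 κ 𝔭' ∅ γ),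
      (∀ (x : Summit.BirchSwinnertonDyer.Rank1Residual.X11b.AcSelmer.XAc (W.baseChange K) 3 κ 𝔭₀ ∅ γ) (s : ↥(Summit.BirchSwinnertonDyer.Rank1Residual.X11b.AcSelmer.selmerAc (W.baseChange K) 3 κ 𝔭' ∅)), ϖ' x s = x (AddSubgroup.inclusion h' s)) →
    ∃ (c m : Literature.NumberTheory.EllipticCurves.UnrSeries 3) (a : ℕ),
      (Literature.NumberTheory.EllipticCurves.Module.charIdeal (Literature.NumberTheory.EllipticCurves.IwasawaAlgebra 3) ↥(Submodule.map ϖ' (Submodule.torsion (Literature.NumberTheory.EllipticCurves.IwasawaAlgebra 3) (Summit.BirchSwinnertonDyer.Rank1Residual.X11b.AcSelmer.XAc (W.baseChange K) 3 κ 𝔭₀ ∅ γ)))).map (PowerSeries.map (Summit.BirchSwinnertonDyer.Rank1Residual.X11b.Halves.toUnr 3)) = Ideal.span {c} ∧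
      ((3 : ℕ) : Literature.NumberTheory.EllipticCurves.UnrSeries 3) ^ a * L = c * m

/-- **(P5) CO-REGULATOR DIVIDES THE COFACTOR [UNDECIDED (≡ the crux on rows where `Ch(ϖ'(T)) = Λ`) · leaf IDEA-NEEDED ·
INSTRUMENTABLE (the MW-row of the co-regulator is EXACT in ψ=0/Honda coordinates: `log_𝔭' y(ζ) = c_φ⁻¹·G'(ζ-1)`; the `Ш`-row is the
research content)]**: with `c, m` as in (P4), the HONDA CO-REGULATOR divides the cofactor: `∃ b, 3^b·m ∈ Ch(X'/ϖ'(T))·R₀⟦T⟧`. -/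
def CoRegulatorDividesCofactorAtThree : Prop :=
  ∀ (W : WeierstrassCurve ℚ) [W.IsElliptic] [W.IsGloballyMinimal] (N : ℕ) [NeZero N] (K : Type) [Field K] [NumberField K] (Dt : Literature.NumberTheory.EllipticCurves.ModularForms.ModularParametrizationData W N), Summit.BirchSwinnertonDyer.Rank1Residual.Additive.ClassO6 W 3 → W.HasSurjectiveModNGaloisRep 3 → W.analyticRank = 1 → W.conductorNorm ℤ = N → Literature.NumberTheory.EllipticCurves.IsImaginaryQuadratic K → Literature.NumberTheory.EllipticCurves.SatisfiesHeegnerHypothesis N K → ∀ (κ : Literature.NumberTheory.EllipticCurves.ZpExtension K 3), κ.IsAnticyclotomic → ∀ (γ : Field.absoluteGaloisGroup K) [Fact (κ.IsTopGenerator γ)] (𝔭 : IsDedekindDomain.HeightOneSpectrum (NumberField.RingOfIntegers K)), ((3 : ℕ) : NumberField.RingOfIntegers K) ∈ 𝔭.asIdeal → 𝔭.asIdeal.ramificationIdx (NumberField.RingOfIntegers ℚ) = 1 → 𝔭.asIdeal.inertiaDeg (NumberField.RingOfIntegers ℚ) = 1 → ∀ (𝔭' : IsDedekindDomain.HeightOneSpectrum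 (NumberField.RingOfIntegers K)), ((3 : ℕ) : NumberField.RingOfIntegers K) ∈ 𝔭'.asIdeal → 𝔭' ≠ 𝔭 → ∀ (ι' : PadicAlgCl 3 ≃+* ℂ), Summit.BirchSwinnertonDyer.BirchSwinnertonDyer.Theorems.SchneiderFree.BranchInducesPrime 3 ι' 𝔭 → ∀ (ΩK : ℂ) (Ωp : ℂ_[3]) (L : Literature.NumberTheory.EllipticCurves.UnrSeries 3), ΩK ≠ 0 → Ωp ≠ 0 → Literature.NumberTheory.EllipticCurves.IsBDPLFunction ι' 𝔭 κ γ Dt.f ΩK Ωp L → Module.IsTorsion (Literature.NumberTheory.EllipticCurves.IwasawaAlgebra 3) (Summit.BirchSwinnertonDyer.Rank1Residual.X11b.AcSelmer.XAc (W.baseChange K) 3 κ 𝔭' ∅ γ) →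
    ∀ (𝔭₀ : IsDedekindDomain.HeightOneSpectrum (NumberField.RingOfIntegers K)), ((3 : ℕ) : NumberField.RingOfIntegers K) ∉ 𝔭₀.asIdeal →
    ∀ (h' : Summit.BirchSwinnertonDyer.Rank1Residual.X11b.AcSelmer.selmerAc (W.baseChange K) 3 κ 𝔭' ∅ ≤ Summit.BirchSwinnertonDyer.Rank1Residual.X11b.AcSelmer.selmerAc (W.baseChange K) 3 κ 𝔭₀ ∅)
      (ϖ' : Summit.BirchSwinnertonDyer.Rank1Residual.X11b.AcSelmer.XAc (W.baseChange K) 3 κ 𝔭₀ ∅ γ →ₗ[Literature.NumberTheory.EllipticCurves.IwasawaAlgebra 3] Summit.BirchSwinnertonDyer.Rank1Residual.X11b.AcSelmer.XAc (W.baseChange K) 3 κ 𝔭' ∅ γ),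
      (∀ (x : Summit.BirchSwinnertonDyer.Rank1Residual.X11b.AcSelmer.XAc (W.baseChange K) 3 κ 𝔭₀ ∅ γ) (s : ↥(Summit.BirchSwinnertonDyer.Rank1Residual.X11b.AcSelmer.selmerAc (W.baseChange K) 3 κ 𝔭' ∅)), ϖ' x s = x (AddSubgroup.inclusion h' s)) →
    ∀ (c m : Literature.NumberTheory.EllipticCurves.UnrSeries 3) (a : ℕ),
      (Literature.NumberTheory.EllipticCurves.Module.charIdeal (Literature.NumberTheory.EllipticCurves.IwasawaAlgebra 3) ↥(Submodule.map ϖ' (Submodule.torsion (Literature.NumberTheory.EllipticCurves.IwasawaAlgebra 3) (Summit.BirchSwinnertonDyer.Rank1Residual.X11b.AcSelmer.XAc (W.baseChange K) 3 κ 𝔭₀ ∅ γ)))).map (PowerSeries.map (Summit.BirchSwinnertonDyer.Rank1Residual.X11b.Halves.toUnr 3)) = Ideal.span {c} →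
      ((3 : ℕ) : Literature.NumberTheory.EllipticCurves.UnrSeries 3) ^ a * L = c * m →
      ∃ b : ℕ, ((3 : ℕ) : Literature.NumberTheory.EllipticCurves.UnrSeries 3) ^ b * m ∈
        (Literature.NumberTheory.EllipticCurves.Module.charIdeal (Literature.NumberTheory.EllipticCurves.IwasawaAlgebra 3) (Summit.BirchSwinnertonDyer.Rank1Residual.X11b.AcSelmer.XAc (W.baseChange K) 3 κ 𝔭' ∅ γ ⧸ (Submodule.map ϖ' (Submodule.torsion (Literature.NumberTheory.EllipticCurves.IwasawaAlgebra 3) (Summit.BirchSwinnertonDyer.Rank1Residual.X11b.AcSelmer.XAc (W.baseChange K) 3 κ 𝔭₀ ∅ γ))))).map (PowerSeries.map (Summit.BirchSwinnertonDyer.Rank1Residual.X11b.Halves.toUnr 3))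

/-! ### Door B — FINE DUAL × STRICT LOG-IMAGE (B-g50-2 / LEAD's determinant door, now TYPED over tree objects) -/

/-- **(P6) FINE/LOG-IMAGE SPLIT [support · leaf ATTACKABLE (same multiplicativity; and the identification
`X'/ϖ'(ker ϖ) = Hom(Sel_(0,0), ℚ/ℤ) = X_(0,0)`: a character of `Sel_(∅,0)` vanishing on `Sel_(∅,0) ⊓ Sel_(0,∅) = Sel_(0,0)` extends by
zero to `Sel_(∅,0) + Sel_(0,∅)` and then to `Sel_(∅,∅)` by divisibility of `ℚ/ℤ`)]**:
`Ch_Λ(X_(∅,0)) = Ch_Λ(ϖ'(ker ϖ)) · Ch_Λ(X_(∅,0)/ϖ'(ker ϖ))` — the second factor is `Ch_Λ(X_(0,0))` (the doubly-strict = FINE dual,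
hitherto not typable in the tree), the first is `ℛ_𝔭 := Ch((loc_𝔭 Sel_(∅,0))^∨)`, the dual of the HONDA-LOG IMAGE of the `𝔭'`-strict
Selmer group inside `H¹(K_{∞,𝔭}, E[3^∞]) ≅ K_{∞,𝔭}/𝔪_∞` — by local duality `= 𝕃_𝔭/loc_𝔭(𝐇_rel)`, LEAD's regulator factor. -/
def FineLogImageSplitAtThree : Prop :=
  ∀ (W : WeierstrassCurve ℚ) [W.IsElliptic] [W.IsGloballyMinimal] (N : ℕ) [NeZero N] (K : Type) [Field K] [NumberField K] (Dt : Literature.NumberTheory.EllipticCurves.ModularForms.ModularParametrizationData W N), Summit.BirchSwinnertonDyer.Rank1Residual.Additive.ClassO6 W 3 → W.HasSurjectiveModNGaloisRep 3 → W.analyticRank = 1 → W.conductorNorm ℤ = N → Literature.NumberTheory.EllipticCurves.IsImaginaryQuadratic K → Literature.NumberTheory.EllipticCurves.SatisfiesHeegnerHypothesis N K → ∀ (κ : Literature.NumberTheory.EllipticCurves.ZpExtension K 3), κ.IsAnticyclotomic → ∀ (γ : Field.absoluteGaloisGroup K) [Fact (κ.IsTopGenerator γ)] (𝔭 : IsDedekindDomain.HeightOneSpectrum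 (NumberField.RingOfIntegers K)), ((3 : ℕ) : NumberField.RingOfIntegers K) ∈ 𝔭.asIdeal → 𝔭.asIdeal.ramificationIdx (NumberField.RingOfIntegers ℚ) = 1 → 𝔭.asIdeal.inertiaDeg (NumberField.RingOfIntegers ℚ) = 1 → ∀ (𝔭' : IsDedekindDomain.HeightOneSpectrum (NumberField.RingOfIntegers K)), ((3 : ℕ) : NumberField.RingOfIntegers K) ∈ 𝔭'.asIdeal → 𝔭' ≠ 𝔭 → ∀ (ι' : PadicAlgCl 3 ≃+* ℂ), Summit.BirchSwinnertonDyer.BirchSwinnertonDyer.Theorems.SchneiderFree.BranchInducesPrime 3 ι' 𝔭 → ∀ (ΩK : ℂ) (Ωp : ℂ_[3]) (L : Literature.NumberTheory.EllipticCurves.UnrSeries 3), ΩK ≠ 0 → Ωp ≠ 0 → Literature.NumberTheory.EllipticCurves.IsBDPLFunction ι' 𝔭 κ γ Dt.f ΩK Ωp L → Module.IsTorsion (Literature.NumberTheory.EllipticCurves.IwasawaAlgebra 3) (Summit.BirchSwinnertonDyer.Rank1Residual.X11b.AcSelmer.XAc (W.baseChange K) 3 κ 𝔭' ∅ γ) 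→
    ∀ (𝔭₀ : IsDedekindDomain.HeightOneSpectrum (NumberField.RingOfIntegers K)), ((3 : ℕ) : NumberField.RingOfIntegers K) ∉ 𝔭₀.asIdeal →
    ∀ (h' : Summit.BirchSwinnertonDyer.Rank1Residual.X11b.AcSelmer.selmerAc (W.baseChange K) 3 κ 𝔭' ∅ ≤ Summit.BirchSwinnertonDyer.Rank1Residual.X11b.AcSelmer.selmerAc (W.baseChange K) 3 κ 𝔭₀ ∅)
      (ϖ' : Summit.BirchSwinnertonDyer.Rank1Residual.X11b.AcSelmer.XAc (W.baseChange K) 3 κ 𝔭₀ ∅ γ →ₗ[Literature.NumberTheory.EllipticCurves.IwasawaAlgebra 3] Summit.BirchSwinnertonDyer.Rank1Residual.X11b.AcSelmer.XAc (W.baseChange K) 3 κ 𝔭' ∅ γ),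
      (∀ (x : Summit.BirchSwinnertonDyer.Rank1Residual.X11b.AcSelmer.XAc (W.baseChange K) 3 κ 𝔭₀ ∅ γ) (s : ↥(Summit.BirchSwinnertonDyer.Rank1Residual.X11b.AcSelmer.selmerAc (W.baseChange K) 3 κ 𝔭' ∅)), ϖ' x s = x (AddSubgroup.inclusion h' s)) →
    ∀ (h : Summit.BirchSwinnertonDyer.Rank1Residual.X11b.AcSelmer.selmerAc (W.baseChange K) 3 κ 𝔭 ∅ ≤ Summit.BirchSwinnertonDyer.Rank1Residual.X11b.AcSelmer.selmerAc (W.baseChange K) 3 κ 𝔭₀ ∅)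
      (ϖ : Summit.BirchSwinnertonDyer.Rank1Residual.X11b.AcSelmer.XAc (W.baseChange K) 3 κ 𝔭₀ ∅ γ →ₗ[Literature.NumberTheory.EllipticCurves.IwasawaAlgebra 3] Summit.BirchSwinnertonDyer.Rank1Residual.X11b.AcSelmer.XAc (W.baseChange K) 3 κ 𝔭 ∅ γ),
      (∀ (x : Summit.BirchSwinnertonDyer.Rank1Residual.X11b.AcSelmer.XAc (W.baseChange K) 3 κ 𝔭₀ ∅ γ) (s : ↥(Summit.BirchSwinnertonDyer.Rank1Residual.X11b.AcSelmer.selmerAc (W.baseChange K) 3 κ 𝔭 ∅)), ϖ x s = x (AddSubgroup.inclusion h s)) →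
    Summit.BirchSwinnertonDyer.Rank1Residual.X11b.AcSelmer.XAc.charIdeal (W.baseChange K) 3 κ 𝔭' ∅ γ =
      Literature.NumberTheory.EllipticCurves.Module.charIdeal (Literature.NumberTheory.EllipticCurves.IwasawaAlgebra 3) ↥(Submodule.map ϖ' (LinearMap.ker ϖ)) *
      Literature.NumberTheory.EllipticCurves.Module.charIdeal (Literature.NumberTheory.EllipticCurves.IwasawaAlgebra 3) (Summit.BirchSwinnertonDyer.Rank1Residual.X11b.AcSelmer.XAc (W.baseChange K) 3 κ 𝔭' ∅ γ ⧸ (Submodule.map ϖ' (LinearMap.ker ϖ)))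

/-- **(P7) STRICT LOG-IMAGE DIVIDES [WEAKER (`ϖ'(ker ϖ) ≤ X'`) · leaf INSTRUMENTABLE (MW-part: ψ=0 vector, exact) / IDEA-NEEDED
(`Ш`-part of `Sel_(∅,0)` and its `𝔭`-adic position)]**: `ℛ_𝔭·R₀⟦T⟧ = (c)` with `3^a·L = c·m`. -/
def StrictLogImageDividesAtThree : Prop :=
  ∀ (W : WeierstrassCurve ℚ) [W.IsElliptic] [W.IsGloballyMinimal] (N : ℕ) [NeZero N] (K : Type) [Field K] [NumberField K] (Dt : Literature.NumberTheory.EllipticCurves.ModularForms.ModularParametrizationData W N), Summit.BirchSwinnertonDyer.Rank1Residual.Additive.ClassO6 W 3 → W.HasSurjectiveModNGaloisRep 3 → W.analyticRank = 1 → W.conductorNorm ℤ = N → Literature.NumberTheory.EllipticCurves.IsImaginaryQuadratic K → Literature.NumberTheory.EllipticCurves.SatisfiesHeegnerHypothesis N K → ∀ (κ : Literature.NumberTheory.EllipticCurves.ZpExtension K 3), κ.IsAnticyclotomic → ∀ (γ : Field.absoluteGaloisGroup K) [Fact (κ.IsTopGenerator γ)] (𝔭 : IsDedekindDomain.HeightOneSpectrum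 (NumberField.RingOfIntegers K)), ((3 : ℕ) : NumberField.RingOfIntegers K) ∈ 𝔭.asIdeal → 𝔭.asIdeal.ramificationIdx (NumberField.RingOfIntegers ℚ) = 1 → 𝔭.asIdeal.inertiaDeg (NumberField.RingOfIntegers ℚ) = 1 → ∀ (𝔭' : IsDedekindDomain.HeightOneSpectrum (NumberField.RingOfIntegers K)), ((3 : ℕ) : NumberField.RingOfIntegers K) ∈ 𝔭'.asIdeal → 𝔭' ≠ 𝔭 → ∀ (ι' : PadicAlgCl 3 ≃+* ℂ), Summit.BirchSwinnertonDyer.BirchSwinnertonDyer.Theorems.SchneiderFree.BranchInducesPrime 3 ι' 𝔭 → ∀ (ΩK : ℂ) (Ωp : ℂ_[3]) (L : Literature.NumberTheory.EllipticCurves.UnrSeries 3), ΩK ≠ 0 → Ωp ≠ 0 → Literature.NumberTheory.EllipticCurves.IsBDPLFunction ι' 𝔭 κ γ Dt.f ΩK Ωp L → Module.IsTorsion (Literature.NumberTheory.EllipticCurves.IwasawaAlgebra 3) (Summit.BirchSwinnertonDyer.Rank1Residual.X11b.AcSelmer.XAc (W.baseChange K) 3 κ 𝔭' ∅ γ) 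→
    ∀ (𝔭₀ : IsDedekindDomain.HeightOneSpectrum (NumberField.RingOfIntegers K)), ((3 : ℕ) : NumberField.RingOfIntegers K) ∉ 𝔭₀.asIdeal →
    ∀ (h' : Summit.BirchSwinnertonDyer.Rank1Residual.X11b.AcSelmer.selmerAc (W.baseChange K) 3 κ 𝔭' ∅ ≤ Summit.BirchSwinnertonDyer.Rank1Residual.X11b.AcSelmer.selmerAc (W.baseChange K) 3 κ 𝔭₀ ∅)
      (ϖ' : Summit.BirchSwinnertonDyer.Rank1Residual.X11b.AcSelmer.XAc (W.baseChange K) 3 κ 𝔭₀ ∅ γ →ₗ[Literature.NumberTheory.EllipticCurves.IwasawaAlgebra 3] Summit.BirchSwinnertonDyer.Rank1Residual.X11b.AcSelmer.XAc (W.baseChange K) 3 κ 𝔭' ∅ γ),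
      (∀ (x : Summit.BirchSwinnertonDyer.Rank1Residual.X11b.AcSelmer.XAc (W.baseChange K) 3 κ 𝔭₀ ∅ γ) (s : ↥(Summit.BirchSwinnertonDyer.Rank1Residual.X11b.AcSelmer.selmerAc (W.baseChange K) 3 κ 𝔭' ∅)), ϖ' x s = x (AddSubgroup.inclusion h' s)) →
    ∀ (h : Summit.BirchSwinnertonDyer.Rank1Residual.X11b.AcSelmer.selmerAc (W.baseChange K) 3 κ 𝔭 ∅ ≤ Summit.BirchSwinnertonDyer.Rank1Residual.X11b.AcSelmer.selmerAc (W.baseChange K) 3 κ 𝔭₀ ∅)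
      (ϖ : Summit.BirchSwinnertonDyer.Rank1Residual.X11b.AcSelmer.XAc (W.baseChange K) 3 κ 𝔭₀ ∅ γ →ₗ[Literature.NumberTheory.EllipticCurves.IwasawaAlgebra 3] Summit.BirchSwinnertonDyer.Rank1Residual.X11b.AcSelmer.XAc (W.baseChange K) 3 κ 𝔭 ∅ γ),
      (∀ (x : Summit.BirchSwinnertonDyer.Rank1Residual.X11b.AcSelmer.XAc (W.baseChange K) 3 κ 𝔭₀ ∅ γ) (s : ↥(Summit.BirchSwinnertonDyer.Rank1Residual.X11b.AcSelmer.selmerAc (W.baseChange K) 3 κ 𝔭 ∅)), ϖ x s = x (AddSubgroup.inclusion h s)) →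
    ∃ (c m : Literature.NumberTheory.EllipticCurves.UnrSeries 3) (a : ℕ),
      (Literature.NumberTheory.EllipticCurves.Module.charIdeal (Literature.NumberTheory.EllipticCurves.IwasawaAlgebra 3) ↥(Submodule.map ϖ' (LinearMap.ker ϖ))).map (PowerSeries.map (Summit.BirchSwinnertonDyer.Rank1Residual.X11b.Halves.toUnr 3)) = Ideal.span {c} ∧
      ((3 : ℕ) : Literature.NumberTheory.EllipticCurves.UnrSeries 3) ^ a * L = c * m

/-- **(P8) FINE DUAL DIVIDES THE COFACTOR [UNDECIDED · leaf IDEA-NEEDED (= the `X_(0,0)` half of LEAD's frame; cf. item 32493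
`K2-rat`, Gu 2025 Conj. 2.15) · INSTRUMENTABLE (`#Sel_(0,0)(K_n, E[3^∞])`, `n = 0, 1`)]**: `∃ b, 3^b·m ∈ Ch(X_(0,0))·R₀⟦T⟧`. -/
def FineDualDividesCofactorAtThree : Prop :=
  ∀ (W : WeierstrassCurve ℚ) [W.IsElliptic] [W.IsGloballyMinimal] (N : ℕ) [NeZero N] (K : Type) [Field K] [NumberField K] (Dt : Literature.NumberTheory.EllipticCurves.ModularForms.ModularParametrizationData W N), Summit.BirchSwinnertonDyer.Rank1Residual.Additive.ClassO6 W 3 → W.HasSurjectiveModNGaloisRep 3 → W.analyticRank = 1 → W.conductorNorm ℤ = N → Literature.NumberTheory.EllipticCurves.IsImaginaryQuadratic K → Literature.NumberTheory.EllipticCurves.SatisfiesHeegnerHypothesis N K → ∀ (κ : Literature.NumberTheory.EllipticCurves.ZpExtension K 3), κ.IsAnticyclotomic → ∀ (γ : Field.absoluteGaloisGroup K) [Fact (κ.IsTopGenerator γ)] (𝔭 : IsDedekindDomain.HeightOneSpectrum (NumberField.RingOfIntegers K)), ((3 : ℕ) : NumberField.RingOfIntegers K) ∈ 𝔭.asIdeal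 → 𝔭.asIdeal.ramificationIdx (NumberField.RingOfIntegers ℚ) = 1 → 𝔭.asIdeal.inertiaDeg (NumberField.RingOfIntegers ℚ) = 1 → ∀ (𝔭' : IsDedekindDomain.HeightOneSpectrum (NumberField.RingOfIntegers K)), ((3 : ℕ) : NumberField.RingOfIntegers K) ∈ 𝔭'.asIdeal → 𝔭' ≠ 𝔭 → ∀ (ι' : PadicAlgCl 3 ≃+* ℂ), Summit.BirchSwinnertonDyer.BirchSwinnertonDyer.Theorems.SchneiderFree.BranchInducesPrime 3 ι' 𝔭 → ∀ (ΩK : ℂ) (Ωp : ℂ_[3]) (L : Literature.NumberTheory.EllipticCurves.UnrSeries 3), ΩK ≠ 0 → Ωp ≠ 0 → Literature.NumberTheory.EllipticCurves.IsBDPLFunction ι' 𝔭 κ γ Dt.f ΩK Ωp L → Module.IsTorsion (Literature.NumberTheory.EllipticCurves.IwasawaAlgebra 3) (Summit.BirchSwinnertonDyer.Rank1Residual.X11b.AcSelmer.XAc (W.baseChange K) 3 κ 𝔭' ∅ γ) →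
    ∀ (𝔭₀ : IsDedekindDomain.HeightOneSpectrum (NumberField.RingOfIntegers K)), ((3 : ℕ) : NumberField.RingOfIntegers K) ∉ 𝔭₀.asIdeal →
    ∀ (h' : Summit.BirchSwinnertonDyer.Rank1Residual.X11b.AcSelmer.selmerAc (W.baseChange K) 3 κ 𝔭' ∅ ≤ Summit.BirchSwinnertonDyer.Rank1Residual.X11b.AcSelmer.selmerAc (W.baseChange K) 3 κ 𝔭₀ ∅)
      (ϖ' : Summit.BirchSwinnertonDyer.Rank1Residual.X11b.AcSelmer.XAc (W.baseChange K) 3 κ 𝔭₀ ∅ γ →ₗ[Literature.NumberTheory.EllipticCurves.IwasawaAlgebra 3] Summit.BirchSwinnertonDyer.Rank1Residual.X11b.AcSelmer.XAc (W.baseChange K) 3 κ 𝔭' ∅ γ),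
      (∀ (x : Summit.BirchSwinnertonDyer.Rank1Residual.X11b.AcSelmer.XAc (W.baseChange K) 3 κ 𝔭₀ ∅ γ) (s : ↥(Summit.BirchSwinnertonDyer.Rank1Residual.X11b.AcSelmer.selmerAc (W.baseChange K) 3 κ 𝔭' ∅)), ϖ' x s = x (AddSubgroup.inclusion h' s)) →
    ∀ (h : Summit.BirchSwinnertonDyer.Rank1Residual.X11b.AcSelmer.selmerAc (W.baseChange K) 3 κ 𝔭 ∅ ≤ Summit.BirchSwinnertonDyer.Rank1Residual.X11b.AcSelmer.selmerAc (W.baseChange K) 3 κ 𝔭₀ ∅)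
      (ϖ : Summit.BirchSwinnertonDyer.Rank1Residual.X11b.AcSelmer.XAc (W.baseChange K) 3 κ 𝔭₀ ∅ γ →ₗ[Literature.NumberTheory.EllipticCurves.IwasawaAlgebra 3] Summit.BirchSwinnertonDyer.Rank1Residual.X11b.AcSelmer.XAc (W.baseChange K) 3 κ 𝔭 ∅ γ),
      (∀ (x : Summit.BirchSwinnertonDyer.Rank1Residual.X11b.AcSelmer.XAc (W.baseChange K) 3 κ 𝔭₀ ∅ γ) (s : ↥(Summit.BirchSwinnertonDyer.Rank1Residual.X11b.AcSelmer.selmerAc (W.baseChange K) 3 κ 𝔭 ∅)), ϖ x s = x (AddSubgroup.inclusion h s)) →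
    ∀ (c m : Literature.NumberTheory.EllipticCurves.UnrSeries 3) (a : ℕ),
      (Literature.NumberTheory.EllipticCurves.Module.charIdeal (Literature.NumberTheory.EllipticCurves.IwasawaAlgebra 3) ↥(Submodule.map ϖ' (LinearMap.ker ϖ))).map (PowerSeries.map (Summit.BirchSwinnertonDyer.Rank1Residual.X11b.Halves.toUnr 3)) = Ideal.span {c} →
      ((3 : ℕ) : Literature.NumberTheory.EllipticCurves.UnrSeries 3) ^ a * L = c * m →
      ∃ b : ℕ, ((3 : ℕ) : Literature.NumberTheory.EllipticCurves.UnrSeries 3) ^ b * m ∈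
        (Literature.NumberTheory.EllipticCurves.Module.charIdeal (Literature.NumberTheory.EllipticCurves.IwasawaAlgebra 3) (Summit.BirchSwinnertonDyer.Rank1Residual.X11b.AcSelmer.XAc (W.baseChange K) 3 κ 𝔭' ∅ γ ⧸ (Submodule.map ϖ' (LinearMap.ker ϖ)))).map (PowerSeries.map (Summit.BirchSwinnertonDyer.Rank1Residual.X11b.Halves.toUnr 3))

/-! ## §B'  The two SPLIT pieces are instances of ONE named folklore fact (checked reductions)

`charIdeal_mul_of_shortExact` (Bourbaki AC VII §4.5 Prop. 10; NSW V §3; tree `Literature…IwasawaAlgebra`, hypothesis-grade) applied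
to `0 → S → X' → X'/S → 0` with `X'` finitely generated (`module_finite_XAc_baseChange`, PROVED in the tree) and torsion (`htor`). -/

/-- (P3) ⟸ multiplicativity of `Ch_Λ` (named fact), checked. -/
theorem torsionCoRegulatorSplit_of_charIdeal_mul
    (hmul : ∀ (M : Type) [AddCommGroup M] [Module (Literature.NumberTheory.EllipticCurves.IwasawaAlgebra 3) M],
      Literature.NumberTheory.EllipticCurves.charIdeal_mul_of_shortExact.{0, 0, 0} 3 M) :
    TorsionCoRegulatorSplitAtThree := by
  intro W _ _ N _ K _ _ Dt hO6 hsurj hr1 hN hK hH κ hκ γ _ 𝔭 h𝔭 he hf 𝔭' h𝔭' hne ι' hι ΩK Ωp L hΩK hΩp hL htor 𝔭₀ h3 h' ϖ' hϖ'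
  haveI : Module.Finite (Literature.NumberTheory.EllipticCurves.IwasawaAlgebra 3) (Summit.BirchSwinnertonDyer.Rank1Residual.X11b.AcSelmer.XAc (W.baseChange K) 3 κ 𝔭' ∅ γ) :=
    Summit.BirchSwinnertonDyer.Rank1Residual.X11b.module_finite_XAc_baseChange 3 κ 𝔭' γ
  unfold Summit.BirchSwinnertonDyer.Rank1Residual.X11b.AcSelmer.XAc.charIdeal
  exact hmul (Summit.BirchSwinnertonDyer.Rank1Residual.X11b.AcSelmer.XAc (W.baseChange K) 3 κ 𝔭' ∅ γ) htor (Submodule.subtype (Submodule.map ϖ' (Submodule.torsion (Literature.NumberTheory.EllipticCurves.IwasawaAlgebra 3) (Summit.BirchSwinnertonDyer.Rank1Residual.X11b.AcSelmer.XAc (W.baseChange K) 3 κ 𝔭₀ ∅ γ)))) (Submodule.mkQ (Submodule.map ϖ' (Submodule.torsion (Literature.NumberTheory.EllipticCurves.IwasawaAlgebra 3) (Summit.BirchSwinnertonDyer.Rank1Residual.X11b.AcSelmer.XAc (W.baseChange K) 3 κ 𝔭₀ ∅ γ))))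
    (Submodule.injective_subtype (Submodule.map ϖ' (Submodule.torsion (Literature.NumberTheory.EllipticCurves.IwasawaAlgebra 3) (Summit.BirchSwinnertonDyer.Rank1Residual.X11b.AcSelmer.XAc (W.baseChange K) 3 κ 𝔭₀ ∅ γ)))) (Submodule.mkQ_surjective (Submodule.map ϖ' (Submodule.torsion (Literature.NumberTheory.EllipticCurves.IwasawaAlgebra 3) (Summit.BirchSwinnertonDyer.Rank1Residual.X11b.AcSelmer.XAc (W.baseChange K) 3 κ 𝔭₀ ∅ γ)))) (LinearMap.exact_subtype_mkQ (Submodule.map ϖ' (Submodule.torsion (Literature.NumberTheory.EllipticCurves.IwasawaAlgebra 3) (Summit.BirchSwinnertonDyer.Rank1Residual.X11b.AcSelmer.XAc (W.baseChange K) 3 κ 𝔭₀ ∅ γ))))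

/-- (P6) ⟸ multiplicativity of `Ch_Λ` (named fact), checked. -/
theorem fineLogImageSplit_of_charIdeal_mul
    (hmul : ∀ (M : Type) [AddCommGroup M] [Module (Literature.NumberTheory.EllipticCurves.IwasawaAlgebra 3) M],
      Literature.NumberTheory.EllipticCurves.charIdeal_mul_of_shortExact.{0, 0, 0} 3 M) :
    FineLogImageSplitAtThree := by
  intro W _ _ N _ K _ _ Dt hO6 hsurj hr1 hN hK hH κ hκ γ _ 𝔭 h𝔭 he hf 𝔭' h𝔭' hne ι' hι ΩK Ωp L hΩK hΩp hL htor 𝔭₀ h3 h' ϖ' hϖ' h ϖ hϖ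
  haveI : Module.Finite (Literature.NumberTheory.EllipticCurves.IwasawaAlgebra 3) (Summit.BirchSwinnertonDyer.Rank1Residual.X11b.AcSelmer.XAc (W.baseChange K) 3 κ 𝔭' ∅ γ) :=
    Summit.BirchSwinnertonDyer.Rank1Residual.X11b.module_finite_XAc_baseChange 3 κ 𝔭' γ
  unfold Summit.BirchSwinnertonDyer.Rank1Residual.X11b.AcSelmer.XAc.charIdeal
  exact hmul (Summit.BirchSwinnertonDyer.Rank1Residual.X11b.AcSelmer.XAc (W.baseChange K) 3 κ 𝔭' ∅ γ) htor (Submodule.subtype (Submodule.map ϖ' (LinearMap.ker ϖ))) (Submodule.mkQ (Submodule.map ϖ' (LinearMap.ker ϖ)))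
    (Submodule.injective_subtype (Submodule.map ϖ' (LinearMap.ker ϖ))) (Submodule.mkQ_surjective (Submodule.map ϖ' (LinearMap.ker ϖ))) (LinearMap.exact_subtype_mkQ (Submodule.map ϖ' (LinearMap.ker ϖ)))

/-! ## §C  Kernels (both conclude the crux BY NAME; degenerate frame `X'` not torsion ⇒ `Ch = Λ`, `k = 0`) -/

/-- **DOOR A (kernel-checked).** (P1) ∧ (P2) ∧ (P3) ∧ (P4) ∧ (P5) ⟹ 24207. -/
theorem rationalSplitIMCInclusionAtThree_of_torsionCoRegulatorDoor
    (hP1 : RelaxationDataAtThree) (hP2 : RestrictionLinearAtThree) (hP3 : TorsionCoRegulatorSplitAtThree)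
    (hP4 : RelaxedTorsionDividesAtThree) (hP5 : CoRegulatorDividesCofactorAtThree) :
    Summit.BirchSwinnertonDyer.BirchSwinnertonDyer.Theses.UniversalToricDescent.RationalSplitIMCInclusionAtThree := by
  intro W _ _ N _ K _ _ Dt hO6 hsurj hr1 hN hK hH κ hκ γ _ 𝔭 h𝔭 he hf 𝔭' h𝔭' hne ι' hι ΩK Ωp L hΩK hΩp hL
  by_cases htor : Module.IsTorsion (Literature.NumberTheory.EllipticCurves.IwasawaAlgebra 3) (Summit.BirchSwinnertonDyer.Rank1Residual.X11b.AcSelmer.XAc (W.baseChange K) 3 κ 𝔭' ∅ γ)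
  · obtain ⟨𝔭₀, h3, h', -⟩ :=
      hP1 W N K Dt hO6 hsurj hr1 hN hK hH κ hκ γ 𝔭 h𝔭 he hf 𝔭' h𝔭' hne ι' hι ΩK Ωp L hΩK hΩp hL htor
    obtain ⟨ϖ', hϖ'⟩ :=
      hP2 W N K Dt hO6 hsurj hr1 hN hK hH κ hκ γ 𝔭 h𝔭 he hf 𝔭' h𝔭' hne ι' hι ΩK Ωp L hΩK hΩp hL htor 𝔭₀ 𝔭' h'
    have hsplit :=
      hP3 W N K Dt hO6 hsurj hr1 hN hK hH κ hκ γ 𝔭 h𝔭 he hf 𝔭' h𝔭' hne ι' hι ΩK Ωp L hΩK hΩp hL htor 𝔭₀ h3 h' ϖ' hϖ'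
    obtain ⟨c, m, a, hc, hLc⟩ :=
      hP4 W N K Dt hO6 hsurj hr1 hN hK hH κ hκ γ 𝔭 h𝔭 he hf 𝔭' h𝔭' hne ι' hι ΩK Ωp L hΩK hΩp hL htor 𝔭₀ h3 h' ϖ' hϖ'
    obtain ⟨b, hm⟩ :=
      hP5 W N K Dt hO6 hsurj hr1 hN hK hH κ hκ γ 𝔭 h𝔭 he hf 𝔭' h𝔭' hne ι' hι ΩK Ωp L hΩK hΩp hL htor 𝔭₀ h3 h' ϖ' hϖ'
        c m a hc hLc
    exact cofactor_door (PowerSeries.map (Summit.BirchSwinnertonDyer.Rank1Residual.X11b.Halves.toUnr 3)) hsplit (mem_of_eq_span hc) hLc hm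
  · refine ⟨0, ?_⟩
    have htop : Summit.BirchSwinnertonDyer.Rank1Residual.X11b.AcSelmer.XAc.charIdeal (W.baseChange K) 3 κ 𝔭' ∅ γ = ⊤ :=
      Summit.BirchSwinnertonDyer.BirchSwinnertonDyer.Theorems.charIdeal_eq_top_of_not_isTorsion (p := 3) _ htor
    rw [htop, Ideal.map_top]; exact Submodule.mem_top

/-- **DOOR B (kernel-checked).** (P1) ∧ (P2) ∧ (P6) ∧ (P7) ∧ (P8) ⟹ 24207. -/
theorem rationalSplitIMCInclusionAtThree_of_fineLogImageDoor
    (hP1 : RelaxationDataAtThree) (hP2 : RestrictionLinearAtThree) (hP6 : FineLogImageSplitAtThree)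
    (hP7 : StrictLogImageDividesAtThree) (hP8 : FineDualDividesCofactorAtThree) :
    Summit.BirchSwinnertonDyer.BirchSwinnertonDyer.Theses.UniversalToricDescent.RationalSplitIMCInclusionAtThree := by
  intro W _ _ N _ K _ _ Dt hO6 hsurj hr1 hN hK hH κ hκ γ _ 𝔭 h𝔭 he hf 𝔭' h𝔭' hne ι' hι ΩK Ωp L hΩK hΩp hL
  by_cases htor : Module.IsTorsion (Literature.NumberTheory.EllipticCurves.IwasawaAlgebra 3) (Summit.BirchSwinnertonDyer.Rank1Residual.X11b.AcSelmer.XAc (W.baseChange K) 3 κ 𝔭' ∅ γ)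
  · obtain ⟨𝔭₀, h3, h', h⟩ :=
      hP1 W N K Dt hO6 hsurj hr1 hN hK hH κ hκ γ 𝔭 h𝔭 he hf 𝔭' h𝔭' hne ι' hι ΩK Ωp L hΩK hΩp hL htor
    obtain ⟨ϖ', hϖ'⟩ :=
      hP2 W N K Dt hO6 hsurj hr1 hN hK hH κ hκ γ 𝔭 h𝔭 he hf 𝔭' h𝔭' hne ι' hι ΩK Ωp L hΩK hΩp hL htor 𝔭₀ 𝔭' h'
    obtain ⟨ϖ, hϖ⟩ :=
      hP2 W N K Dt hO6 hsurj hr1 hN hK hH κ hκ γ 𝔭 h𝔭 he hf 𝔭' h𝔭' hne ι' hι ΩK Ωp L hΩK hΩp hL htor 𝔭₀ 𝔭 h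
    have hsplit :=
      hP6 W N K Dt hO6 hsurj hr1 hN hK hH κ hκ γ 𝔭 h𝔭 he hf 𝔭' h𝔭' hne ι' hι ΩK Ωp L hΩK hΩp hL htor 𝔭₀ h3 h' ϖ' hϖ' h ϖ hϖ
    obtain ⟨c, m, a, hc, hLc⟩ :=
      hP7 W N K Dt hO6 hsurj hr1 hN hK hH κ hκ γ 𝔭 h𝔭 he hf 𝔭' h𝔭' hne ι' hι ΩK Ωp L hΩK hΩp hL htor 𝔭₀ h3 h' ϖ' hϖ' h ϖ hϖ
    obtain ⟨b, hm⟩ :=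
      hP8 W N K Dt hO6 hsurj hr1 hN hK hH κ hκ γ 𝔭 h𝔭 he hf 𝔭' h𝔭' hne ι' hι ΩK Ωp L hΩK hΩp hL htor 𝔭₀ h3 h' ϖ' hϖ' h ϖ hϖ
        c m a hc hLc
    exact cofactor_door (PowerSeries.map (Summit.BirchSwinnertonDyer.Rank1Residual.X11b.Halves.toUnr 3)) hsplit (mem_of_eq_span hc) hLc hm
  · refine ⟨0, ?_⟩
    have htop : Summit.BirchSwinnertonDyer.Rank1Residual.X11b.AcSelmer.XAc.charIdeal (W.baseChange K) 3 κ 𝔭' ∅ γ = ⊤ :=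
      Summit.BirchSwinnertonDyer.BirchSwinnertonDyer.Theorems.charIdeal_eq_top_of_not_isTorsion (p := 3) _ htor
    rw [htop, Ideal.map_top]; exact Submodule.mem_top

end Summit.BirchSwinnertonDyer.BirchSwinnertonDyer.Cruxes.RationalSplitIMCInclusionAtThree.PsiZeroHondaFrame

end
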